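import Literature.NumberTheory.Transcendental.AnalytificationUnramified
import Literature.NumberTheory.Transcendental.AnalytificationConnected
import Literature.AlgebraicGeometry.Morphisms.FormallyUnramifiedOfClosedPoints
import Literature.AlgebraicGeometry.Morphisms.ClosedImmersionOfUnramifiedInjective
import Literature.RingTheory.Etale.MaximalIdealMapOfCotangentSurjective
import HarnessLib

/-!
# A proper morphism of smooth complex varieties which is injective with immersive analytification is a closed immersion

Topic `Literature/NumberTheory/Transcendental`, namespace `Literature.NumberTheory.Transcendental`.
THEOREMS ONLY.

Assembly of the GAGA-at-a-point comparison (`AnalytificationUnramified`: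
`𝔪_x ⊆ 𝔪_y 𝒪_{X,x} + 𝔪_x²` when `T_p fᵃⁿ` is injective) with Nakayama
(`Literature.RingTheory.Etale.map_maximalIdeal_eq_of_le_sup_sq_of_isNoetherianRing`), the
closed-point criterion for formal unramifiedness
(`Literature.AlgebraicGeometry.Morphisms.formallyUnramified_of_forall_isClosed_map_maximalIdeal`)
and «proper + unramified + injective on `ℂ`-points ⇒ closed immersion»
(`Literature.AlgebraicGeometry.Morphisms.isClosedImmersion_left_of_isProper_of_formallyUnramified_of_injective_complexPoints`):

* `IsAnalytification.map_maximalIdeal_stalkMap_eq_of_injective_mfderiv` — `𝔪_y 𝒪_{X,x} = 𝔪_x`;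
* `residueFieldMap_surjective_complexPoint` — `κ(y) → κ(x)` is onto at a `ℂ`-point (`κ = ℂ`);
* `IsAnalytification.formallyUnramified_left_of_injective_mfderiv` — if `fᵃⁿ` is an immersion
  (injective differential at every point) then `f` is (formally) unramified
  (SGA 1 XII Prop. 3.1 (v): `f` unramified ⇔ `fᵃⁿ` unramified);
* `IsAnalytification.isClosedImmersion_left_of_isProper_of_injective_of_injective_mfderiv` — if
  moreover `f` is proper and injective on `ℂ`-points, `f` is a closed immersion
  (EGA IV₄ 18.12.6 / SGA 1 XII Prop. 3.1: the standard criterion «proper injective immersion of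
  complex manifolds ⇒ closed embedding», algebraic form).

## References

* [SGA1] A. Grothendieck, M. Raynaud, *SGA 1*, LNM 224 (1971), Exp. XII, Prop. 3.1, Cor. 1.2.
* [Grothendieck1967] A. Grothendieck, *EGA IV₄*, Publ. Math. IHÉS 32 (1967), Cor. 18.12.6,
  Cor. 17.4.2.
* [SerreGAGA1956] J.-P. Serre, *GAGA*, Ann. Inst. Fourier 6 (1956), §2 n°6 Prop. 3 Cor. 2.
-/

noncomputable section

universe u

open CategoryTheory AlgebraicGeometry Topology Filter TopologicalSpace Opposite
open scoped Manifold ContDiff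
open Literature.AlgebraicGeometry.Motives (AlgPoints ComplexPoints SchemeOver)
open Literature.AlgebraicGeometry.Motives.AlgPoints

namespace Literature.NumberTheory.Transcendental

/-- **`κ(x) = ℂ` at a complex point, so `κ(f x) → κ(x)` is onto.**  For a morphism `f : X ⟶ Y` of
`ℂ`-schemes locally of finite type and a `ℂ`-point `P` of `X`, the residue field map
`κ(f(pt P)) → κ(pt P)` is surjective: both residue fields are `ℂ` through `P.resHom`,
`(f ∘ P).resHom` (`ComplexPoints.resHom_eq`). [cite: Grothendieck1967, IV₄ Cor. 17.4.2] -/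
theorem residueFieldMap_surjective_complexPoint {X Y : SchemeOver ℂ} [LocallyOfFiniteType X.hom]
    [LocallyOfFiniteType Y.hom] (f : X ⟶ Y) (P : ComplexPoints X) :
    Function.Surjective (IsLocalRing.ResidueField.map (f.left.stalkMap P.pt).hom) := by
  intro r
  -- `c := P.resHom r ∈ ℂ`, `r' := (f P).resHom⁻¹ c ∈ κ(f x)`
  have hiso : IsIso (AlgPoints.map f P).resHom := by
    rw [ComplexPoints.resHom_eq]; infer_instance
  obtain ⟨r', hr'⟩ := (ConcreteCategory.bijective_of_isIso (AlgPoints.map f P).resHom).2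
    (P.resHom r)
  refine ⟨r', P.resHom.hom.injective ?_⟩
  have h := AlgPoints.resHom_map f P
  have h' : (AlgPoints.map f P).resHom r' = P.resHom (f.left.residueFieldMap P.pt r') := by
    rw [h]; rfl
  rw [← hr', h']
  rfl

namespace IsAnalytification

variable {E : Type*} [NormedAddCommGroup E] [NormedSpace ℂ E] [FiniteDimensional ℂ E]
  {M : Type*} [TopologicalSpace M] [ChartedSpace E M] [IsManifold 𝓘(ℂ, E) ω M]
  {E' : Type*} [NormedAddCommGroup E'] [NormedSpace ℂ E'] [FiniteDimensional ℂ E']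
  {M' : Type*} [TopologicalSpace M'] [ChartedSpace E' M'] [IsManifold 𝓘(ℂ, E') ω M']
  {X Y : SchemeOver ℂ} {n m : ℕ} {φ : M → ComplexPoints X} {ψ : M' → ComplexPoints Y}

/-- **Unramified at a point with injective analytic differential**: under the hypotheses of
`maximalIdeal_le_map_stalkMap_sup_sq_of_injective_mfderiv`, `𝔪_y 𝒪_{X,x} = 𝔪_x`
(Nakayama in the Noetherian local ring `𝒪_{X,x}`).
[cite: SGA1, Exp. XII Prop. 3.1 (v)] [cite: Grothendieck1967, IV₄ Cor. 17.4.2] -/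
theorem map_maximalIdeal_stalkMap_eq_of_injective_mfderiv
    [LocallyOfFiniteType X.hom] [SmoothOfRelativeDimension n X.hom]
    [LocallyOfFiniteType Y.hom] [SmoothOfRelativeDimension m Y.hom]
    (hφ : IsAnalytification E X n φ) (hψ : IsAnalytification E' Y m ψ) (f : X ⟶ Y)
    (fan : M → M') (hcomm : ∀ q, ψ (fan q) = AlgPoints.map f (φ q)) (p : M)
    (hfan : MDifferentiableAt 𝓘(ℂ, E) 𝓘(ℂ, E') fan p)
    (hinj : Function.Injective (mfderiv 𝓘(ℂ, E) 𝓘(ℂ, E') fan p))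
    {x : X.left} (hx : (φ p).pt = x) :
    (IsLocalRing.maximalIdeal (Y.left.presheaf.stalk (f.left.base x))).map
        (f.left.stalkMap x).hom =
      IsLocalRing.maximalIdeal (X.left.presheaf.stalk x) := by
  haveI : IsLocallyNoetherian X.left := LocallyOfFiniteType.isLocallyNoetherian X.hom
  exact Literature.RingTheory.Etale.map_maximalIdeal_eq_of_le_sup_sq_of_isNoetherianRing _
    (maximalIdeal_le_map_stalkMap_sup_sq_of_injective_mfderiv hφ hψ f fan hcomm p hfan hinj hx)

/-- **An immersion of complex manifolds over `f` makes `f` unramified.**  Let `f : X ⟶ Y` be a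
morphism of smooth `ℂ`-schemes with analytifications `φ`, `ψ` (holomorphic atlases) and a map
`fᵃⁿ : M → M'` over `f`, differentiable with injective differential at every point.  Then `f`
is formally unramified (hence unramified, being locally of finite type): closed points of `X`
are the `pt(φ p)` (Nullstellensatz, `ComplexPoints.equivClosedPoints`; `φ` onto), where
`𝔪_y 𝒪_{X,x} = 𝔪_x` (`map_maximalIdeal_stalkMap_eq_of_injective_mfderiv`) and `κ(y) → κ(x) = ℂ`
is onto; conclude by `formallyUnramified_of_forall_isClosed_map_maximalIdeal`.
[cite: SGA1, Exp. XII Prop. 3.1 (v)] -/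
theorem formallyUnramified_left_of_injective_mfderiv
    [LocallyOfFiniteType X.hom] [SmoothOfRelativeDimension n X.hom]
    [LocallyOfFiniteType Y.hom] [SmoothOfRelativeDimension m Y.hom]
    (hφ : IsAnalytification E X n φ) (hψ : IsAnalytification E' Y m ψ) (f : X ⟶ Y)
    (fan : M → M') (hcomm : ∀ q, ψ (fan q) = AlgPoints.map f (φ q))
    (hfan : ∀ p, MDifferentiableAt 𝓘(ℂ, E) 𝓘(ℂ, E') fan p)
    (hinj : ∀ p, Function.Injective (mfderiv 𝓘(ℂ, E) 𝓘(ℂ, E') fan p)) :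
    FormallyUnramified f.left := by
  haveI : LocallyOfFiniteType f.left := by
    have : LocallyOfFiniteType (f.left ≫ Y.hom) := by rw [Over.w f]; infer_instance
    exact locallyOfFiniteType_of_comp f.left Y.hom
  haveI : JacobsonSpace ↥X.left := LocallyOfFiniteType.jacobsonSpace X.hom
  -- every closed point is `pt (φ p)`
  have hpt : ∀ x : X.left, IsClosed ({x} : Set X.left) → ∃ p, (φ p).pt = x := by
    intro x hx
    obtain ⟨p, hp⟩ := hφ.isHomeomorph.surjective ((ComplexPoints.equivClosedPoints X).symm ⟨x, hx⟩)
    exact ⟨p, by rw [hp]; exact ComplexPoints.pt_equivClosedPoints_symm_apply ⟨x, hx⟩⟩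
  refine Literature.AlgebraicGeometry.Morphisms.formallyUnramified_of_forall_isClosed_map_maximalIdeal
    f.left (fun x hx ↦ ?_) (fun x hx ↦ ?_)
  · obtain ⟨p, rfl⟩ := hpt x hx
    exact residueFieldMap_surjective_complexPoint f (φ p)
  · obtain ⟨p, hp⟩ := hpt x hx
    exact map_maximalIdeal_stalkMap_eq_of_injective_mfderiv hφ hψ f fan hcomm p (hfan p) (hinj p) hp

/-- **Proper + injective + immersive analytification ⇒ closed immersion.**  Let `f : X ⟶ Y` be a
morphism of smooth `ℂ`-schemes which is proper and injective on `ℂ`-points, with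
analytifications `φ`, `ψ` and a map `fᵃⁿ` over `f` whose differential is injective at every
point.  Then `f` is a closed immersion. [cite: SGA1, Exp. XII Prop. 3.1 and Cor. 1.2]
[cite: Grothendieck1967, IV₄ Cor. 18.12.6] -/
theorem isClosedImmersion_left_of_isProper_of_injective_of_injective_mfderiv
    [LocallyOfFiniteType X.hom] [SmoothOfRelativeDimension n X.hom]
    [LocallyOfFiniteType Y.hom] [SmoothOfRelativeDimension m Y.hom]
    (hφ : IsAnalytification E X n φ) (hψ : IsAnalytification E' Y m ψ) (f : X ⟶ Y)
    [IsProper f.left]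
    (hinjpt : Function.Injective (AlgPoints.map f : ComplexPoints X → ComplexPoints Y))
    (fan : M → M') (hcomm : ∀ q, ψ (fan q) = AlgPoints.map f (φ q))
    (hfan : ∀ p, MDifferentiableAt 𝓘(ℂ, E) 𝓘(ℂ, E') fan p)
    (hinj : ∀ p, Function.Injective (mfderiv 𝓘(ℂ, E) 𝓘(ℂ, E') fan p)) :
    IsClosedImmersion f.left := by
  haveI : FormallyUnramified f.left :=
    formallyUnramified_left_of_injective_mfderiv hφ hψ f fan hcomm hfan hinj
  exact Literature.AlgebraicGeometry.Morphisms.isClosedImmersion_left_of_isProper_of_formallyUnramified_of_injective_complexPoints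
    f hinjpt

end IsAnalytification

end Literature.NumberTheory.Transcendental
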